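import Mathlib
import Literature.Combinatorics.Optimization.PseudoDensityFourier

/-!
# Max 3-Sat: no small semidefinite relaxation beats `7/8` (Lee–Raghavendra–Steurer 2015, Thm 1.5
and the consequence of Thm 1.6 on p. 6), DERIVED from the typed engine facts

Sixth file of the tree's Lee–Raghavendra–Steurer story (`CorrelationPolytopePsdRank`,
`PatternMatrixPsdRank`, `SDPRelaxationsMaxCSP`, `SosPseudoDensityDuality`, `PseudoDensityFourier`).
Nothing new is vendored here: this file ASSEMBLES, as theorems, the two Max 3-Sat lower bounds that
the paper obtains by combining its general theorems with the linear-degree sum-of-squares lower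
bound of Grigoriev/Schoenebeck (typed as the named fact `Schoenebeck2008_maxThreeSatSos`, LRS Thm 6.5):

* p. 6, after Thm 1.6: "we know that `O(1)`-degree sos upper bounds do not achieve an approximation
  ratio better than `7/8` for Max 3-Sat [Grigoriev2001, schoenebeck2008linear], therefore Theorem 1.6
  implies that polynomial-size SDP relaxations for Max 3-Sat cannot achieve an approximation ratio
  better than `7/8`."  — `LeeRaghavendraSteurer2015_thm16.maxThreeSat_poly`: for all `7/8 < s`,
  `c < 1` and every exponent `C`, for `n ≥ n₀(s,c,C)` no subspace `U` of functions on `{0,1}ⁿ` with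
  `dim U ≤ n^C` achieves a `(c,s)`-approximation for Max 3-Sat; from `LeeRaghavendraSteurer2015_thm16`
  (itself a theorem modulo Thm 3.8, `LeeRaghavendraSteurer2015_thm16_of_thm38`) and Thm 6.5.
* Thm 1.5 (p. 6) with its printed proof (p. 26–27: "In Theorem 6.4, choose `n ≍ log N` and
  `d(n) ≍ log N / log log N` so that `n^{4d(n)} ≍ N`. In that case, the lower bound obtained is of the
  order `N^{d(n)/32} ≍ N^{Ω(log N / log log N)}`") — `LeeRaghavendraSteurer2015_thm15_approx_of_thm64_repaired`:
  there is an absolute `α > 0` such that for all `7/8 < s < c < 1` and `n ≥ n₀(s,c)`, no subspace of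
  dimension `≤ n^{α log n / log log n}` achieves a `(c,s)`-approximation for Max 3-Sat on `n`
  variables; from the corrected Thm 6.4 (`LeeRaghavendraSteurer2015_thm64_repaired`, a theorem modulo
  Thm 3.8 by `LeeRaghavendraSteurer2015_thm64_repaired_of_thm38`) and Thm 6.5, with the choice
  `d(n) = ⌊c' n⌋` (`c' = min(c_ε, 1)`, `c_ε` Schoenebeck's constant) and `n = ⌊log N / (8 c' log log N)⌋`.
  Both are then stated modulo `LeeRaghavendraSteurer2015_thm38` + `Schoenebeck2008_maxThreeSatSos` only
  (`…_of_thm38`).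

RECORDED DISCREPANCY (not a repair of the typed fact).  The verbatim typing
`LeeRaghavendraSteurer2015_thm15` (sibling file `SDPRelaxationsMaxCSP`) follows the printed sentence:
ONE instance `ℑ` with `max(ℑ) ≤ s` and "`sos_U(ℑ) = 1`", i.e. `U` certifies no `c < 1` for that `ℑ`,
with `α = α(s)`.  The printed proof establishes, for each FIXED `c < 1`, that `U` fails to achieve a
`(c,s)`-approximation (the instance depends on `c`, and the threshold beyond which the bound bites
depends on `c` through the constant `K = K(Π, d, ε, s, c)` of Thm 6.4, `ε = (1 − c)/2 → 0` as
`c → 1`); this is the gloss "(i.e., `U` fails to achieve a factor-`s` approximation for Max 3-Sat)"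
of the printed statement, and it is what is proved below.  The one-instance form implies it
(`LeeRaghavendraSteurer2015_thm15.not_achievesApprox`); the converse is not addressed in print and is
not claimed here.

Source: J. R. Lee, P. Raghavendra, D. Steurer, *Lower bounds on the size of semidefinite programming
relaxations*, STOC 2015 [LeeRaghavendraSteurer2015]; held text `paper:arxiv-1411.6317` (locators =
pages of that rendering: Thm 1.5 p. 6; Thm 6.4, Thm 6.5 and the "`n ≍ log N`" paragraph p. 26–27).
-/

noncomputable section

open Finset Filter

namespace Literature.Combinatorics.Optimization

/-! ### Degree monotonicity and the failure of low-degree sos on Max 3-Sat (Thm 6.5 unfolded) -/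

/-- A degree-`d` sum-of-squares certificate is a degree-`d'` certificate for every `d' ≥ d`.
[cite: LeeRaghavendraSteurer2015, Def. 1.3 (p. 5)] -/
theorem HasSosCertificate.of_degree_le {m d d' : ℕ} {f : (Fin m → Bool) → ℝ}
    (hf : HasSosCertificate d f) (h : d ≤ d') : HasSosCertificate d' f := by
  obtain ⟨k, g, hg, hfx⟩ := hf
  exact ⟨k, g, fun i => (hg i).mono (Nat.div_le_div_right h), hfx⟩

/-- **Thm 6.5 in `(c,s)`-approximation currency:** for every `ε > 0` there are `c_ε > 0` and `n₀`
such that for all `n ≥ n₀`, every degree `d ≤ ⌊c_ε n⌋` and every `c < 1`, the degree-`d` sos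
relaxation (squares of functions of degree `≤ d/2`) fails to achieve a `(c, 7/8 + ε)`-approximation
for Max 3-Sat on `n` variables (witness: Schoenebeck's instance `ℑ_n`).
[cite: LeeRaghavendraSteurer2015, Thm 6.5 (p. 26)] -/
theorem Schoenebeck2008_maxThreeSatSos.not_achievesApprox (h65 : Schoenebeck2008_maxThreeSatSos)
    {ε : ℝ} (hε : 0 < ε) :
    ∃ cε : ℝ, 0 < cε ∧ ∃ n₀ : ℕ, ∀ n : ℕ, n₀ ≤ n → ∀ d : ℕ, d ≤ ⌊cε * n⌋₊ →
      ∀ c : ℝ, c < 1 → ¬ AchievesApprox maxThreeSatPreds (degreeLE n (d / 2)) c (7 / 8 + ε) := by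
  obtain ⟨cε, hcε, n₀, H⟩ := h65 ε hε
  refine ⟨cε, hcε, n₀, fun n hn d hd c hc hA => ?_⟩
  obtain ⟨I, hI, hnot⟩ := H n hn
  have h1 : SubspaceSos (degreeLE n (d / 2)) I.val c := hA I hI
  rw [subspaceSos_degreeLE_iff] at h1
  exact hnot c hc (h1.of_degree_le hd)

/-! ### Polynomial-size SDP relaxations do not beat `7/8` (p. 6, from Thm 1.6 and Thm 6.5) -/

/-- `(log n)^{C+1} ≤ a·n` for `n` large (`log^k = o(id)`). [folklore] -/
private theorem eventually_pow_log_le_mul (C : ℕ) {a : ℝ} (ha : 0 < a) :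
    ∃ n₀ : ℕ, ∀ n : ℕ, n₀ ≤ n → Real.log n ^ (C + 1) ≤ a * n := by
  have hev : ∀ᶠ x : ℝ in atTop, Real.log x ^ (C + 1) ≤ a * x := by
    have hb := (Real.isLittleO_pow_log_id_atTop (n := C + 1)).bound ha
    filter_upwards [hb, eventually_ge_atTop (0 : ℝ)] with x hx hx0
    rw [id, Real.norm_eq_abs, Real.norm_eq_abs, abs_of_nonneg hx0] at hx
    exact (le_abs_self _).trans hx
  obtain ⟨n₀, hn₀⟩ := eventually_atTop.1 (tendsto_natCast_atTop_atTop.eventually hev)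
  exact ⟨n₀, hn₀⟩

/-- **Lee–Raghavendra–Steurer 2015, p. 6: "polynomial-size SDP relaxations for Max 3-Sat cannot
achieve an approximation ratio better than `7/8`"**, DERIVED from Thm 1.6 and Thm 6.5: for all
`s > 7/8`, `c < 1` and `C ∈ ℕ` there is `n₀` such that for every `n ≥ n₀`, no subspace `U` of functions
`{0,1}ⁿ → ℝ` with `dim U ≤ n^C` achieves a `(c,s)`-approximation for Max 3-Sat on `n` variables.
Proof as printed: Thm 6.5 gives, for `d = 4C + 4` and `m` large, the failure of the degree-`≤ d`
functions on `{0,1}^m` (`2d ≤ c_ε m`); Thm 1.6 then excludes every `U` with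
`dim U ≤ α (n / log n)^{C+1}`, and `n^C ≤ α (n/log n)^{C+1}` for `n` large.
[cite: LeeRaghavendraSteurer2015, Thm 1.6 and the paragraph following it (p. 6)] -/
theorem LeeRaghavendraSteurer2015_thm16.maxThreeSat_poly (h16 : LeeRaghavendraSteurer2015_thm16)
    (h65 : Schoenebeck2008_maxThreeSatSos) :
    ∀ s : ℝ, 7 / 8 < s → ∀ c : ℝ, c < 1 → ∀ C : ℕ, ∃ n₀ : ℕ, ∀ n : ℕ, n₀ ≤ n →
      ∀ U : Submodule ℝ ((Fin n → Bool) → ℝ), (Module.finrank ℝ U : ℝ) ≤ (n : ℝ) ^ C →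
        ¬ AchievesApprox maxThreeSatPreds (U : Set ((Fin n → Bool) → ℝ)) c s := by
  intro s hs c hc C
  obtain ⟨cε, hcε, n₁, H⟩ := h65.not_achievesApprox (by linarith : 0 < s - 7 / 8)
  -- `d = 4C + 4`, and `m ≥ n₁` with `2d ≤ ⌊cε m⌋`
  set d : ℕ := 4 * C + 4 with hd
  set m : ℕ := max n₁ ⌈((2 * d : ℕ) : ℝ) / cε⌉₊ with hm
  have hm₁ : n₁ ≤ m := le_max_left _ _
  have h2d : 2 * d ≤ ⌊cε * m⌋₊ := by
    apply Nat.le_floor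
    have h1 : ((2 * d : ℕ) : ℝ) / cε ≤ m :=
      (Nat.le_ceil _).trans (by rw [hm]; exact_mod_cast le_max_right _ _)
    rw [div_le_iff₀ hcε] at h1
    linarith
  have hfail : ¬ AchievesApprox maxThreeSatPreds (degreeLE m d) c s := by
    have h1 := H m hm₁ (2 * d) h2d c hc
    rwa [show 7 / 8 + (s - 7 / 8) = s by ring, Nat.mul_div_cancel_left d two_pos] at h1
  obtain ⟨α, hα, n₂, H16⟩ := h16 3 maxThreeSatPreds c s m d hfail
  obtain ⟨n₃, hn₃⟩ := eventually_pow_log_le_mul C hα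
  refine ⟨max (max n₂ n₃) 2, fun n hn U hU => H16 n ?_ U ?_⟩
  · exact le_trans (le_max_left _ _) (le_trans (le_max_left _ _) hn)
  have hn2 : (2 : ℝ) ≤ n := by exact_mod_cast le_trans (le_max_right _ _) hn
  have hn0 : (0 : ℝ) < n := by linarith
  have hlog : 0 < Real.log n := Real.log_pos (by linarith)
  have hlogle : Real.log n ^ (C + 1) ≤ α * n :=
    hn₃ n (le_trans (le_max_right _ _) (le_trans (le_max_left _ _) hn))
  have hexp : ((d : ℝ) / 4) = ((C + 1 : ℕ) : ℝ) := by
    rw [hd]; push_cast; ring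
  rw [hexp, Real.rpow_natCast, div_pow]
  calc (Module.finrank ℝ U : ℝ) ≤ (n : ℝ) ^ C := hU
    _ = (n : ℝ) ^ (C + 1) * Real.log n ^ (C + 1) / Real.log n ^ (C + 1) / n := by
        field_simp
        ring
    _ ≤ (n : ℝ) ^ (C + 1) * (α * n) / Real.log n ^ (C + 1) / n := by
        gcongr
    _ = α * ((n : ℝ) ^ (C + 1) / Real.log n ^ (C + 1)) := by
        field_simp

/-- The same, modulo Theorem 3.8 and Thm 6.5 only (`LeeRaghavendraSteurer2015_thm16_of_thm38`).
[cite: LeeRaghavendraSteurer2015, Thm 1.6 and the paragraph following it (p. 6)] -/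
theorem LeeRaghavendraSteurer2015_thm38.maxThreeSat_poly (h38 : LeeRaghavendraSteurer2015_thm38)
    (h65 : Schoenebeck2008_maxThreeSatSos) :
    ∀ s : ℝ, 7 / 8 < s → ∀ c : ℝ, c < 1 → ∀ C : ℕ, ∃ n₀ : ℕ, ∀ n : ℕ, n₀ ≤ n →
      ∀ U : Submodule ℝ ((Fin n → Bool) → ℝ), (Module.finrank ℝ U : ℝ) ≤ (n : ℝ) ^ C →
        ¬ AchievesApprox maxThreeSatPreds (U : Set ((Fin n → Bool) → ℝ)) c s :=
  (LeeRaghavendraSteurer2015_thm16_of_thm38 h38).maxThreeSat_poly h65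

/-! ### Theorem 1.5 (quasi-polynomial bound) from the corrected Theorem 6.4 and Theorem 6.5 -/

/-- **The closing arithmetic of the printed proof of Thm 1.5** ("choose `n ≍ log N` and
`d(n) ≍ log N / log log N` so that `n^{4d(n)} ≍ N` … the lower bound obtained is of the order
`N^{d(n)/32} ≍ N^{Ω(log N/ log log N)}`", p. 26–27), in real variables: for `L = log N` beyond a
threshold depending only on `c', K, T`, every `x ∈ [A − 1, A]`, `A = L / (8 c' log L)` (the integer
`n`), and every `δ ∈ [c'x − 1, c'x]` (the degree `d(n) = ⌊c' n⌋`) satisfy `x ≥ T`,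
`4 δ log x < L` (i.e. `n^{4 d(n)} < N`) and `L²/(32768 log L) ≤ log K + (δ²/8) log x`
(i.e. `N^{log N /(32768 log log N)} ≤ K n^{d(n)²/8}`).
[cite: LeeRaghavendraSteurer2015, proof of Thm 1.5 after Thm 6.5 (p. 26–27)] -/
theorem thm15_core_eventually {c' T : ℝ} (K : ℝ) (hc' : 0 < c') (hc'1 : c' ≤ 1)
    (hT : 4 / c' ≤ T) :
    ∀ᶠ L : ℝ in atTop, 0 < L ∧ 0 < Real.log L ∧ ∀ x δ : ℝ,
      L / (8 * c' * Real.log L) - 1 ≤ x → x ≤ L / (8 * c' * Real.log L) →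
      c' * x - 1 ≤ δ → δ ≤ c' * x →
      T ≤ x ∧ 4 * δ * Real.log x < L ∧
        L ^ 2 / (32768 * Real.log L) ≤ Real.log K + δ ^ 2 / 8 * Real.log x := by
  have hc'ne : c' ≠ 0 := hc'.ne'
  have hT4 : 4 ≤ T := by
    refine le_trans ?_ hT
    rw [le_div_iff₀ hc']
    nlinarith
  filter_upwards [eventually_ge_atTop (Real.exp (1 / (8 * c'))), eventually_ge_atTop ((64 * c') ^ 4),
    eventually_ge_atTop ((T + 1) ^ 2), eventually_ge_atTop (32768 * |Real.log K|),
    Real.tendsto_log_atTop.eventually_ge_atTop (2 : ℝ)] with L h1 h2 h3 h4 hLL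
  -- positivity of `L` and `log L`
  have hL25 : 25 ≤ L := le_trans (by nlinarith) h3
  have hL0 : 0 < L := by linarith
  set LL := Real.log L with hLLdef
  have hLL0 : 0 < LL := by linarith
  have hLLne : LL ≠ 0 := hLL0.ne'
  have h8 : 1 ≤ 8 * c' * LL := by
    have h : 1 / (8 * c') ≤ LL := by
      rw [hLLdef, ← Real.log_exp (1 / (8 * c'))]
      exact Real.log_le_log (Real.exp_pos _) h1
    rw [div_le_iff₀ (by positivity)] at h
    linarith
  set A := L / (8 * c' * LL) with hAdef
  have hA0 : 0 < A := by positivity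
  have hAL : A ≤ L := div_le_self hL0.le h8
  -- `u = L^{1/4}`: `log L ≤ 4u`, `u ≥ 64 c'`, hence `A ≥ 2 u² = 2 √L`
  set u := Real.sqrt (Real.sqrt L) with hudef
  have hsqrtL0 : 0 < Real.sqrt L := Real.sqrt_pos.2 hL0
  have hu0 : 0 < u := Real.sqrt_pos.2 hsqrtL0
  have hu2 : u ^ 2 = Real.sqrt L := Real.sq_sqrt hsqrtL0.le
  have hu4 : u ^ 4 = L := by
    rw [show u ^ 4 = (u ^ 2) ^ 2 by ring, hu2, Real.sq_sqrt hL0.le]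
  have hLLu : LL ≤ 4 * u := by
    have h : LL = 4 * Real.log u := by
      rw [hLLdef, ← hu4, Real.log_pow]; norm_num
    rw [h]
    have := Real.log_le_sub_one_of_pos hu0
    linarith
  have hu64 : 64 * c' ≤ u := by
    by_contra h
    push Not at h
    have h' : u ^ 4 < (64 * c') ^ 4 := pow_lt_pow_left₀ h hu0.le (by norm_num)
    linarith
  have hA2s : 2 * Real.sqrt L ≤ A := by
    rw [← hu2]
    have h32 : L / (32 * c' * u) ≤ A := by
      rw [hAdef]
      apply div_le_div_of_nonneg_left hL0.le (by positivity)
      nlinarith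
    refine le_trans ?_ h32
    rw [le_div_iff₀ (by positivity)]
    have hu3 : 0 ≤ u ^ 3 := by positivity
    calc 2 * u ^ 2 * (32 * c' * u) = 64 * c' * u ^ 3 := by ring
      _ ≤ u * u ^ 3 := mul_le_mul_of_nonneg_right hu64 hu3
      _ = L := by rw [← hu4]; ring
  have hTs : T + 1 ≤ Real.sqrt L := by
    have h : Real.sqrt ((T + 1) ^ 2) = T + 1 := Real.sqrt_sq (by linarith)
    rw [← h]
    exact Real.sqrt_le_sqrt h3
  refine ⟨hL0, hLL0, fun x δ hx1 hx2 hδ1 hδ2 => ?_⟩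
  -- bounds on `x` and `δ`
  have hxT : T ≤ x := by linarith
  have hx1' : 1 ≤ x := by linarith
  have hx0 : 0 < x := by linarith
  have hxA2 : A / 2 ≤ x := by linarith
  have hxs : Real.sqrt L ≤ x := by linarith
  have hcx : 4 ≤ c' * x := by
    have h := mul_le_mul_of_nonneg_left (hT.trans hxT) hc'.le
    rwa [show c' * (4 / c') = 4 by field_simp] at h
  have hδ0 : 0 ≤ δ := by linarith
  have hδ : c' * x / 2 ≤ δ := by linarith
  -- logarithms: `LL/2 ≤ log x ≤ LL`
  have hlogx0 : 0 ≤ Real.log x := Real.log_nonneg hx1'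
  have hlogxLL : Real.log x ≤ LL := by
    rw [hLLdef]; exact Real.log_le_log hx0 (hx2.trans hAL)
  have hlogx_ge : LL / 2 ≤ Real.log x := by
    have h : Real.log (Real.sqrt L) = LL / 2 := by rw [hLLdef, Real.log_sqrt hL0.le]
    rw [← h]; exact Real.log_le_log hsqrtL0 hxs
  refine ⟨hxT, ?_, ?_⟩
  · -- `n^{4 d(n)} < N`
    have hδA : δ ≤ c' * A := hδ2.trans (mul_le_mul_of_nonneg_left hx2 hc'.le)
    calc 4 * δ * Real.log x ≤ 4 * (c' * A) * LL :=
          mul_le_mul (by linarith) hlogxLL hlogx0 (by positivity)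
      _ = L / 2 := by rw [hAdef]; field_simp; ring
      _ < L := by linarith
  · -- `N^{α log N / log log N} ≤ K n^{d(n)²/8}`
    have hmain : L ^ 2 / (16384 * LL) ≤ δ ^ 2 / 8 * Real.log x := by
      have hq : (c' * A / 4) ^ 2 ≤ δ ^ 2 := by
        apply pow_le_pow_left₀ (by positivity)
        have := mul_le_mul_of_nonneg_left hxA2 hc'.le
        linarith
      calc L ^ 2 / (16384 * LL) = (c' * A / 4) ^ 2 / 8 * (LL / 2) := by
            rw [hAdef]; field_simp; ring
        _ ≤ δ ^ 2 / 8 * Real.log x :=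
            mul_le_mul (by linarith) hlogx_ge (by positivity) (by positivity)
    have hLLL : LL ≤ L := by
      have := Real.log_le_sub_one_of_pos hL0; rw [hLLdef]; linarith
    have hK' : |Real.log K| ≤ L ^ 2 / (32768 * LL) := by
      rw [le_div_iff₀ (by positivity)]
      have h : 32768 * |Real.log K| * LL ≤ L * L := mul_le_mul h4 hLLL hLL0.le hL0.le
      nlinarith
    have hK'' : -Real.log K ≤ |Real.log K| := neg_le_abs _
    have hsum : L ^ 2 / (32768 * LL) + L ^ 2 / (32768 * LL) = L ^ 2 / (16384 * LL) := by
      field_simp; ring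
    linarith

/-- **Lee–Raghavendra–Steurer 2015, Theorem 1.5, in the form its printed proof delivers, DERIVED
from the corrected Theorem 6.4 and Theorem 6.5:** there is an absolute constant `α > 0`
(`α = 1/32768` here) such that for all `7/8 < s < c < 1` there is `n₀` with: for every `n ≥ n₀`, no
subspace `U` of functions `{0,1}ⁿ → ℝ` with `dim U ≤ n^{α log n / log log n}` achieves a
`(c,s)`-approximation for Max 3-Sat on `n` variables — "`U` fails to achieve a factor-`s`
approximation for Max 3-Sat".  Proof as printed (p. 26–27): Thm 6.5 makes the degree-`d(m)` sos
relaxation, `d(m) = ⌊c' m⌋` (`c' = min(c_ε, 1)`, `ε = s − 7/8`), fail to achieve `(c + (1−c)/2, s)`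
on `m` variables for all large `m`; the corrected Thm 6.4 (`LeeRaghavendraSteurer2015_thm64_repaired`,
psd-rank currency of Prop. 6.1) then bounds the psd rank of `M^{n,Π}_{c,s}` below by `K m^{d(m)²/8}`
for `n > m^{4d(m)}`; with `m = ⌊log n / (8 c' log log n)⌋` this is `≥ n^{α log n / log log n}`
(`thm15_core_eventually`), and Prop. 1.13 (`AchievesApprox.hasPsdFactorization`) turns an achieving
`U` into a psd factorisation of size `dim U`.  See the module docstring for the relation to the
verbatim typing `LeeRaghavendraSteurer2015_thm15` (one instance with `sos_U(ℑ) = 1`), which is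
formally stronger and is NOT derived here.
[cite: LeeRaghavendraSteurer2015, Thm 1.5 (p. 6) and its proof after Thm 6.5 (p. 26–27)] -/
theorem LeeRaghavendraSteurer2015_thm15_approx_of_thm64_repaired
    (h64 : LeeRaghavendraSteurer2015_thm64_repaired) (h65 : Schoenebeck2008_maxThreeSatSos) :
    ∃ α : ℝ, 0 < α ∧ ∀ s : ℝ, 7 / 8 < s → ∀ c : ℝ, s < c → c < 1 →
      ∃ n₀ : ℕ, ∀ n : ℕ, n₀ ≤ n → ∀ U : Submodule ℝ ((Fin n → Bool) → ℝ),
        (Module.finrank ℝ U : ℝ) ≤ (n : ℝ) ^ (α * Real.log n / Real.log (Real.log n)) →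
        ¬ AchievesApprox maxThreeSatPreds (U : Set ((Fin n → Bool) → ℝ)) c s := by
  refine ⟨1 / 32768, by norm_num, fun s hs c hsc hc1 => ?_⟩
  -- Thm 6.5
  obtain ⟨cε, hcε, n₁, H65⟩ := h65.not_achievesApprox (by linarith : 0 < s - 7 / 8)
  -- the degree function `d(m) = ⌊c' m⌋`, `c' = min(c_ε, 1)`
  set c' : ℝ := min cε 1 with hc'def
  have hc'0 : 0 < c' := lt_min hcε one_pos
  have hc'1 : c' ≤ 1 := min_le_right _ _
  have hc'ε : c' ≤ cε := min_le_left _ _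
  set d : ℕ → ℕ := fun m => ⌊c' * m⌋₊ with hddef
  have hdmono : Monotone d := fun a b hab =>
    Nat.floor_le_floor (mul_le_mul_of_nonneg_left (Nat.cast_le.2 hab) hc'0.le)
  have hdtend : Tendsto d atTop atTop :=
    tendsto_nat_floor_atTop.comp (Tendsto.const_mul_atTop hc'0 tendsto_natCast_atTop_atTop)
  -- the corrected Thm 6.4 at `(ε', s, c)`, `ε' = (1 - c)/2`
  set ε' : ℝ := (1 - c) / 2 with hε'def
  have hε' : 0 < ε' := by rw [hε'def]; linarith
  have hcε' : c + ε' < 1 := by rw [hε'def]; linarith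
  obtain ⟨K, hK, H64⟩ := h64 3 maxThreeSatPreds d hdmono hdtend ε' s c hε' (by linarith) hsc hc1.le
  -- the arithmetic, transported to `L = log n`
  set T : ℝ := max (4 / c') (n₁ : ℝ) with hTdef
  have hT : 4 / c' ≤ T := le_max_left _ _
  obtain ⟨N₀, hN₀⟩ := eventually_atTop.1
    ((Real.tendsto_log_atTop.comp tendsto_natCast_atTop_atTop).eventually
      (thm15_core_eventually K hc'0 hc'1 hT))
  refine ⟨N₀, fun N hN U hU hA => ?_⟩
  obtain ⟨hL0, hLL0, hxδ⟩ := hN₀ N hN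
  simp only [Function.comp_apply] at hL0 hLL0 hxδ
  have hN0 : (0 : ℝ) < N := by
    rcases Nat.eq_zero_or_pos N with h | h
    · simp [h] at hL0
    · exact_mod_cast h
  set L : ℝ := Real.log N with hLdef
  -- `m = ⌊L / (8 c' log L)⌋` and `d(m)`
  set m : ℕ := ⌊L / (8 * c' * Real.log L)⌋₊ with hmdef
  have hA0 : 0 ≤ L / (8 * c' * Real.log L) := by positivity
  have hx1 : L / (8 * c' * Real.log L) - 1 ≤ (m : ℝ) := (Nat.sub_one_lt_floor _).le
  have hx2 : (m : ℝ) ≤ L / (8 * c' * Real.log L) := Nat.floor_le hA0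
  have hcm0 : 0 ≤ c' * m := by positivity
  have hδ1 : c' * m - 1 ≤ ((d m : ℕ) : ℝ) := (Nat.sub_one_lt_floor _).le
  have hδ2 : ((d m : ℕ) : ℝ) ≤ c' * m := Nat.floor_le hcm0
  obtain ⟨hTx, hb, hc⟩ := hxδ m (d m) hx1 hx2 hδ1 hδ2
  -- thresholds: `m ≥ n₁`, `m ≥ 1`, `4 ≤ d(m) ≤ m`, `d(m) ≤ ⌊c_ε m⌋`
  have hn₁ : n₁ ≤ m := by
    have h : (n₁ : ℝ) ≤ m := (le_max_right _ _).trans hTx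
    exact_mod_cast h
  have hcm4 : (4 : ℝ) ≤ c' * m := by
    have h := mul_le_mul_of_nonneg_left (hT.trans hTx) hc'0.le
    rwa [show c' * (4 / c') = 4 by field_simp] at h
  have hm1 : 1 ≤ m := by
    have h : (1 : ℝ) ≤ m := by
      have := mul_le_mul_of_nonneg_right hc'1 (Nat.cast_nonneg m)
      linarith
    exact_mod_cast h
  have hd4 : 2 * ((3 + 1) / 2) ≤ d m := by
    show 4 ≤ d m
    exact Nat.le_floor (by exact_mod_cast hcm4)
  have hdm : d m ≤ m := by
    have h := Nat.floor_le_floor (show c' * m ≤ (m : ℝ) by nlinarith)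
    simpa using h
  have hdε : d m ≤ ⌊cε * m⌋₊ :=
    Nat.floor_le_floor (mul_le_mul_of_nonneg_right hc'ε (Nat.cast_nonneg m))
  -- failure of the degree-`d(m)` relaxation at `(c + ε', s)` on `m` variables
  have hfail : ¬ AchievesApprox maxThreeSatPreds (degreeLE m (d m / 2)) (c + ε') s := by
    have h := H65 m hn₁ (d m) hdε (c + ε') hcε'
    rwa [show 7 / 8 + (s - 7 / 8) = s by ring] at h
  -- `m^{4 d(m)} < N`
  have hx0 : (0 : ℝ) < m := by exact_mod_cast hm1
  have hC3 : (m : ℝ) ^ (4 * d m) < N := by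
    have h1 : (m : ℝ) ^ (4 * d m) = Real.exp (4 * (d m : ℝ) * Real.log m) := by
      rw [← Real.rpow_natCast, Real.rpow_def_of_pos hx0]
      congr 1
      push_cast
      ring
    rw [h1]
    calc Real.exp (4 * (d m : ℝ) * Real.log m) < Real.exp L := Real.exp_lt_exp.2 hb
      _ = N := by rw [hLdef, Real.exp_log hN0]
  -- `dim U ≤ N^{α log N / log log N} ≤ K m^{d(m)²/8}`
  have hC4 : (Module.finrank ℝ U : ℝ) ≤ K * (m : ℝ) ^ (((d m : ℕ) : ℝ) ^ 2 / 8) := by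
    refine hU.trans ?_
    rw [Real.rpow_def_of_pos hN0, Real.rpow_def_of_pos hx0, ← hLdef]
    calc Real.exp (L * (1 / 32768 * L / Real.log L))
        = Real.exp (L ^ 2 / (32768 * Real.log L)) := by
          congr 1
          field_simp
      _ ≤ Real.exp (Real.log K + ((d m : ℕ) : ℝ) ^ 2 / 8 * Real.log m) := Real.exp_le_exp.2 hc
      _ = K * Real.exp (Real.log m * (((d m : ℕ) : ℝ) ^ 2 / 8)) := by
          rw [Real.exp_add, Real.exp_log hK, mul_comm (Real.log (m : ℝ))]
  exact H64 m hm1 hd4 hdm hfail N hC3 (Module.finrank ℝ U) hC4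
    (AchievesApprox.hasPsdFactorization U hA)

/-- **Thm 1.5 (in the form its proof delivers) modulo Theorem 3.8 and Thm 6.5 only**, composing
with `LeeRaghavendraSteurer2015_thm64_repaired_of_thm38`.
[cite: LeeRaghavendraSteurer2015, Thm 1.5 (p. 6) and its proof (p. 26–27)] -/
theorem LeeRaghavendraSteurer2015_thm38.maxThreeSat_quasipoly (h38 : LeeRaghavendraSteurer2015_thm38)
    (h65 : Schoenebeck2008_maxThreeSatSos) :
    ∃ α : ℝ, 0 < α ∧ ∀ s : ℝ, 7 / 8 < s → ∀ c : ℝ, s < c → c < 1 →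
      ∃ n₀ : ℕ, ∀ n : ℕ, n₀ ≤ n → ∀ U : Submodule ℝ ((Fin n → Bool) → ℝ),
        (Module.finrank ℝ U : ℝ) ≤ (n : ℝ) ^ (α * Real.log n / Real.log (Real.log n)) →
        ¬ AchievesApprox maxThreeSatPreds (U : Set ((Fin n → Bool) → ℝ)) c s :=
  LeeRaghavendraSteurer2015_thm15_approx_of_thm64_repaired
    (LeeRaghavendraSteurer2015_thm64_repaired_of_thm38 h38) h65

/-! ### The verbatim Theorem 1.5 implies the `(c,s)` form -/

/-- The verbatim typing of Thm 1.5 (one instance `ℑ` with `sos_U(ℑ) = 1`) implies the form its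
printed proof delivers: small `U` fail to achieve a `(c,s)`-approximation for every `c < 1`.
[cite: LeeRaghavendraSteurer2015, Thm 1.5 (p. 6)] -/
theorem LeeRaghavendraSteurer2015_thm15.not_achievesApprox (h15 : LeeRaghavendraSteurer2015_thm15) :
    ∀ s : ℝ, 7 / 8 < s → ∃ α : ℝ, 0 < α ∧ ∃ n₀ : ℕ, ∀ n : ℕ, n₀ ≤ n →
      ∀ U : Submodule ℝ ((Fin n → Bool) → ℝ),
        (Module.finrank ℝ U : ℝ) ≤ (n : ℝ) ^ (α * Real.log n / Real.log (Real.log n)) →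
        ∀ c : ℝ, c < 1 → ¬ AchievesApprox maxThreeSatPreds (U : Set ((Fin n → Bool) → ℝ)) c s := by
  intro s hs
  obtain ⟨α, hα, n₀, H⟩ := h15 s hs
  refine ⟨α, hα, n₀, fun n hn U hU c hc hA => ?_⟩
  obtain ⟨I, hI, hnot⟩ := H n hn U hU
  exact hnot c hc (hA I hI)

end Literature.Combinatorics.Optimization

end
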